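import Summits.CriticalPhenomena.PercolationContinuityZ3.Theorems.PercNearOneGluingNoHeavyQuantLawDecFlowsDecomposition
import Summits.CriticalPhenomena.PercolationContinuityZ3.Theorems.PercNearOneGluingNoHeavyQuantLawDecUsageMonge
import Summits.CriticalPhenomena.PercolationContinuityZ3.Theorems.PercNearOneGluingNoHeavyQuantBlobDecTwoLaw
import HarnessLib

/-!
# QUANT lane R8, T-DEC: the light two-blob law, sub-cases "a low" / "b low" — part 1, THE FLOW: one low blob atom shipped entirely to the
# top, atom `0` split between the other mid and the top (certificate (I\*) of FOR-PROVERS-SL §4b as a `LawDec.FlowAtT` datum)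

builds on p205010 (kernel theorem, internal audit signed; external expert review pending)

Support file (`--supports stmt-CriticalPhenomena-4575`), QUANT lane typer seat prim-quant-stmt (gen 23), rung R8 of
`run/shared/lean/prim/quant/LADDER.md`.  Theorems only, standard axioms, no sorries.  The remaining sub-cases of the typed
`LawDec.LightTwoBlobDEC` (`…QuantSliceLightBelow`; sub-case O is `…QuantLightTwoBlobCaseO`, the affordable region `…QuantLightTwoBlobTools`)
are those where one of the two blob atoms is LOW.  Write the law as `LAW2[p, u; q, v]` (atoms `0, p, q, p+q`, masses `(1−u)(1−v)`, `u(1−v)`,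
`(1−u)v`, `uv`) with the low blob atom `p` (`2p < T`) the smaller one (`p < q`, so `q` and `p + q` are self-sufficient and `T < p + q`).
CERTIFICATE (I\*) = (S1): `p` is shipped ENTIRELY to the top `p + q` at its minimal credit gate; atom `0` ships an amount `F` to the mid `q`
(`F = (1−u)v / usage(0,q)` = the capacity of `q` when `T < q`, else `0`) and the rest to the top.  This file turns that into a kernel statement
with the two numerical facts left as hypotheses:

* `LawDec.usage0_eq_heavy` / `usage0_eq_light` / `usage_eq_heavy'` / `usage_eq_light'` — closed forms of `LawDec.usage` for a mid absorber on
  the heavy (`x ≤ ρ`) resp. light (`ρ ≤ x`) side, `ρ = (T − 2l)/(h − l)` (from `usage_mid_eq`'s two metrics `heavy_of_rho` / `light_of_rho`).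
* **`LawDec.twoBlob_decAtT_of_lowFlow`**: `0 < x < 1`, gates `u, v ∈ [0,1]`, `1 ≤ p < q`, `p + q ≤ j″`, `2p < T < p + q`, `0 ≤ F ≤ (1−u)(1−v)`,
  (`0 < F → T < q ∧ usage(0,q)·F ≤ (1−u)v`), and the TOP INEQUALITY `usage(p, p+q)·u(1−v) + usage(0, p+q)·((1−u)(1−v) − F) ≤ uv`
  ⟹ `DECAtT x T j″ (p+q) LAW2[p, u; q, v]` (via `LawDec.decAtT_of_flowAtT`, p288500).
* `LawDec.law2_swap` — `LAW2[b, γ; a, g] = LAW2[a, g; b, γ]` (so "a low" is the same statement with the roles of the blobs exchanged).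
Parts 2–4 (`…QuantLightTwoBlobPoly*`, `…Cells*`) discharge the top inequality cell by cell (light/heavy status of the two pairs into the top,
`T < q` or not) by exact polynomial certificates (Handelman products found by LP on the compute farm, kit j136370/j136639, replayed by
`linarith`), and `…QuantLightTwoBlobDEC` assembles `LawDec.LightTwoBlobDEC`.

[this work]; DEC rules ARCH-TREES-G49 §2.2 / DEC-TAMP-G50 §3.1, flow normal form `…QuantLawDecFlows` (this lane).  The gluing rows served
[cite: KozmaNitzan2024, Conjecture 3 (p. 15)]; product measure [cite: Grimmett1999, §1.3 p. 10].
-/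

noncomputable section

namespace Summit.CriticalPhenomena.PercolationContinuityZ3.Theorems

namespace Quant

open Finset

/-- the two-blob law `(1−u)(1−v)δ₀ + u(1−v)δ_a + (1−u)vδ_b + uvδ_{a+b}` evaluated at `h` (as in `…QuantBlobDecTwoLawParts`) -/
local notation3 "LAW2[" a ", " u ", " b ", " v ", " h "]" =>
  (1 - (u : ℝ)) * (1 - (v : ℝ)) * (if (h : ℕ) = 0 then (1 : ℝ) else 0)
    + (u : ℝ) * (1 - (v : ℝ)) * (if (h : ℕ) = (a : ℕ) then (1 : ℝ) else 0)
    + (1 - (u : ℝ)) * (v : ℝ) * (if (h : ℕ) = (b : ℕ) then (1 : ℝ) else 0)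
    + (u : ℝ) * (v : ℝ) * (if (h : ℕ) = (a : ℕ) + (b : ℕ) then (1 : ℝ) else 0)

namespace LawDec

/-! ### Closed forms of the usage rate of a mid absorber -/

/-- **usage of a mid on the HEAVY side**: `h ≤ j′`, `2l < T < l + h`, `0 < x < 1` and `x ≤ ρ = (T−2l)/(h−l)` ⟹
`usage(l,h) = (T − 2l)/(l + h − T)`. [this work] -/
theorem usage_eq_heavy' (x T : ℝ) (j' l h : ℕ) (hx0 : 0 < x) (hx1 : x < 1) (hhj : h ≤ j') (hlow : 2 * (l : ℝ) < T)
    (hcomp : T < (l : ℝ) + h) (hρ : x * ((h : ℝ) - l) ≤ T - 2 * (l : ℝ)) :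
    usage x T j' l h = (T - 2 * (l : ℝ)) / ((l : ℝ) + h - T) := by
  have hd : (0 : ℝ) < (h : ℝ) - l := by linarith
  rw [usage_mid_eq x T j' l h hx0 hx1 hhj hlow hcomp]
  refine max_eq_left ?_
  -- light metric ≤ heavy metric when `x ≤ ρ`
  have hden1 : 0 < (l : ℝ) + h - T := by linarith
  have hden2 : 0 < (1 - x) * ((1 - x) * (l : ℝ) + (1 + x) * h - T) := by
    apply mul_pos (by linarith); nlinarith
  rw [div_le_div_iff₀ hden2 hden1]
  nlinarith [mul_nonneg (sub_nonneg.2 hρ) hd.le, mul_nonneg (sub_nonneg.2 hρ) (mul_pos hx0 hd).le,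
    mul_nonneg (mul_nonneg (sub_nonneg.2 hρ) hd.le) (by linarith : (0:ℝ) ≤ 1 - x)]

/-- **usage of a mid on the LIGHT side**: `h ≤ j′`, `2l < T < l + h`, `0 < x < 1` and `ρ = (T−2l)/(h−l) ≤ x` ⟹
`usage(l,h) = (x²(h−l) + (1−x)(T−2l)) / ((1−x)((1−x)l + (1+x)h − T))`. [this work] -/
theorem usage_eq_light' (x T : ℝ) (j' l h : ℕ) (hx0 : 0 < x) (hx1 : x < 1) (hhj : h ≤ j') (hlow : 2 * (l : ℝ) < T)
    (hcomp : T < (l : ℝ) + h) (hρ : T - 2 * (l : ℝ) ≤ x * ((h : ℝ) - l)) :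
    usage x T j' l h = (x ^ 2 * ((h : ℝ) - l) + (1 - x) * (T - 2 * (l : ℝ))) / ((1 - x) * ((1 - x) * (l : ℝ) + (1 + x) * h - T)) := by
  have hd : (0 : ℝ) < (h : ℝ) - l := by linarith
  rw [usage_mid_eq x T j' l h hx0 hx1 hhj hlow hcomp]
  refine max_eq_right ?_
  have hden1 : 0 < (l : ℝ) + h - T := by linarith
  have hden2 : 0 < (1 - x) * ((1 - x) * (l : ℝ) + (1 + x) * h - T) := by
    apply mul_pos (by linarith); nlinarith
  rw [div_le_div_iff₀ hden1 hden2]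
  nlinarith [mul_nonneg (sub_nonneg.2 hρ) hd.le, mul_nonneg (sub_nonneg.2 hρ) (mul_pos hx0 hd).le,
    mul_nonneg (mul_nonneg (sub_nonneg.2 hρ) hd.le) (by linarith : (0:ℝ) ≤ 1 - x),
    mul_nonneg (sub_nonneg.2 hρ) (by linarith : (0:ℝ) ≤ T - 2 * l)]

/-- **usage of a mid for the low atom `0`, heavy side**: `x·h ≤ T < h ≤ j′` ⟹ `usage(0,h) = T/(h − T)`. [this work] -/
theorem usage0_eq_heavy (x T : ℝ) (j' h : ℕ) (hx0 : 0 < x) (hx1 : x < 1) (hhj : h ≤ j') (hT : 0 < T) (hcomp : T < (h : ℝ))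
    (hρ : x * (h : ℝ) ≤ T) : usage x T j' 0 h = T / ((h : ℝ) - T) := by
  rw [usage_eq_heavy' x T j' 0 h hx0 hx1 hhj (by simpa using hT) (by simpa using hcomp) (by simpa using hρ)]
  simp

/-- **usage of a mid for the low atom `0`, light side**: `T ≤ x·h`, `T < h ≤ j′` ⟹
`usage(0,h) = (x²h + (1−x)T)/((1−x)((1+x)h − T))`. [this work] -/
theorem usage0_eq_light (x T : ℝ) (j' h : ℕ) (hx0 : 0 < x) (hx1 : x < 1) (hhj : h ≤ j') (hT : 0 < T) (hcomp : T < (h : ℝ))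
    (hρ : T ≤ x * (h : ℝ)) : usage x T j' 0 h = (x ^ 2 * (h : ℝ) + (1 - x) * T) / ((1 - x) * ((1 + x) * (h : ℝ) - T)) := by
  rw [usage_eq_light' x T j' 0 h hx0 hx1 hhj (by simpa using hT) (by simpa using hcomp) (by simpa using hρ)]
  simp

/-! ### The law with the blobs exchanged -/

/-- `LAW2[b, γ; a, g] = LAW2[a, g; b, γ]` (the law of `b·Bern(γ) + a·Bern(g)` does not depend on the order of the summands). [this work] -/
theorem law2_swap (a b : ℕ) (γ g : ℝ) : (fun h => LAW2[b, γ, a, g, h]) = (fun h => LAW2[a, g, b, γ, h]) := by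
  funext h
  rw [Nat.add_comm b a]
  ring

/-! ### The flow -/

/-- **DEC OF THE TWO-BLOB LAW FROM THE ONE-LOW-BLOB FLOW (certificate (I\*) = S1).**  Law `LAW2[p, u; q, v]` (atoms `0, p, q, p+q`),
floor `0 < x < 1`, gates `u, v ∈ [0,1]`, `1 ≤ p < q`, `p + q ≤ j″` (no giants), target `T` with `2p < T < p + q` (atom `p` low, `q` and `p+q`
self-sufficient and compatible with both low atoms).  Flow: `p ↦ p+q` (all of `u(1−v)`), `0 ↦ q` (amount `F`, `0 ≤ F ≤ (1−u)(1−v)`, and when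
`F > 0`: `T < q` and `usage(0,q)·F ≤ (1−u)v`), `0 ↦ p+q` (the rest).  If the top is not overloaded —
`usage(p,p+q)·u(1−v) + usage(0,p+q)·((1−u)(1−v) − F) ≤ uv` — then `DECAtT x T j″ (p+q) LAW2[p, u; q, v]`. [this work] -/
theorem twoBlob_decAtT_of_lowFlow (x u v T F : ℝ) (p q j'' : ℕ) (hx0 : 0 < x) (hx1 : x < 1) (hu0 : 0 ≤ u) (hu1 : u ≤ 1)
    (hv0 : 0 ≤ v) (hv1 : v ≤ 1) (hp : 1 ≤ p) (hpq : p < q) (hj : p + q ≤ j'') (h2p : 2 * (p : ℝ) < T) (hTpq : T < (p : ℝ) + q)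
    (hF0 : 0 ≤ F) (hF1 : F ≤ (1 - u) * (1 - v)) (hFq : 0 < F → T < (q : ℝ) ∧ usage x T j'' 0 q * F ≤ (1 - u) * v)
    (hS : usage x T j'' p (p + q) * (u * (1 - v)) + usage x T j'' 0 (p + q) * ((1 - u) * (1 - v) - F) ≤ u * v) :
    DECAtT x T j'' (p + q) (fun h => LAW2[p, u, q, v, h]) := by
  classical
  have hT0 : 0 < T := by have : (0:ℝ) ≤ p := Nat.cast_nonneg p; linarith
  have hq' : (p : ℝ) < q := by exact_mod_cast hpq
  -- the flow
  set R : ℝ := (1 - u) * (1 - v) - F with hR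
  have hR0 : 0 ≤ R := by rw [hR]; linarith
  have hmp : 0 ≤ u * (1 - v) := mul_nonneg hu0 (by linarith)
  set f : ℕ → ℕ → ℝ := fun l h =>
    u * (1 - v) * (if l = p then (1:ℝ) else 0) * (if h = p + q then (1:ℝ) else 0)
      + F * (if l = 0 then (1:ℝ) else 0) * (if h = q then (1:ℝ) else 0)
      + R * (if l = 0 then (1:ℝ) else 0) * (if h = p + q then (1:ℝ) else 0) with hf
  have ind_nn : ∀ (P : Prop) [Decidable P], (0:ℝ) ≤ (if P then (1:ℝ) else 0) := fun P _ => by split_ifs <;> norm_num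
  refine decAtT_of_flowAtT x T j'' (p + q) _ hx0 hx1 (fun h hh => BlobDec2.law_eq_zero_of_lt p q u v h hh)
    (BlobDec2.law_mass p q u v) ⟨f, ?_, ?_, ?_, ?_⟩
  · -- nonnegativity
    intro l h
    simp only [hf]
    have i1 := ind_nn (l = p); have i2 := ind_nn (h = p + q); have i3 := ind_nn (l = 0); have i4 := ind_nn (h = q)
    have := mul_nonneg (mul_nonneg hmp i1) i2
    have := mul_nonneg (mul_nonneg hF0 i3) i4
    have := mul_nonneg (mul_nonneg hR0 i3) i2
    linarith
  · -- support: used pairs are (p, p+q), (0, q) [only if F > 0], (0, p+q)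
    intro l h hpos
    simp only [hf] at hpos
    by_cases hl : l = p
    · rw [if_pos hl, if_neg (show l ≠ 0 by omega)] at hpos
      simp only [mul_one, mul_zero, zero_mul, add_zero] at hpos
      by_cases hh : h = p + q
      · refine ⟨by omega, by rw [hl]; exact h2p, by omega, Or.inr ?_⟩
        rw [hl, hh]; push_cast; linarith
      · rw [if_neg hh, mul_zero] at hpos; exact absurd hpos (lt_irrefl 0)
    · rw [if_neg hl] at hpos
      by_cases hl0 : l = 0
      · rw [if_pos hl0] at hpos
        simp only [mul_one, mul_zero, zero_mul, zero_add] at hpos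
        by_cases hh : h = q
        · rw [if_pos hh, if_neg (show h ≠ p + q by omega), mul_one, mul_zero, add_zero] at hpos
          obtain ⟨hTq, _⟩ := hFq hpos
          refine ⟨by omega, by rw [hl0]; simpa using hT0, by omega, Or.inr ?_⟩
          rw [hl0, hh]; simpa using hTq
        · rw [if_neg hh, mul_zero, zero_add] at hpos
          by_cases hh' : h = p + q
          · refine ⟨by omega, by rw [hl0]; simpa using hT0, by omega, Or.inr ?_⟩
            rw [hl0, hh']; push_cast; linarith
          · rw [if_neg hh', mul_zero] at hpos; exact absurd hpos (lt_irrefl 0)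
      · rw [if_neg hl0] at hpos
        simp only [mul_zero, zero_mul, add_zero] at hpos
        exact absurd hpos (lt_irrefl 0)
  · -- every low atom is shipped exactly
    intro l hlj hlow
    have hsum : ∑ h ∈ Finset.range (p + q + 1), f l h
        = u * (1 - v) * (if l = p then (1:ℝ) else 0) + F * (if l = 0 then (1:ℝ) else 0) + R * (if l = 0 then (1:ℝ) else 0) := by
      simp only [hf, Finset.sum_add_distrib]
      rw [BlobDec2.sum_range_const_indicator _ (p + q) le_rfl, BlobDec2.sum_range_const_indicator _ q (by omega),
        BlobDec2.sum_range_const_indicator _ (p + q) le_rfl]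
    rw [hsum]
    dsimp only
    -- the low atoms of the law among `l` with `2l < T`: `0` and `p` (not `q`, `p+q`)
    have hlq : l ≠ q := by rintro rfl; linarith
    have hlpq : l ≠ p + q := by rintro rfl; push_cast at hlow; linarith [(Nat.cast_nonneg p : (0:ℝ) ≤ p)]
    by_cases hl0 : l = 0
    · have hlp : l ≠ p := by omega
      rw [if_neg hlp, if_pos hl0, if_neg hlq, if_neg hlpq, hR]; ring
    · by_cases hl : l = p
      · rw [if_pos hl, if_neg hl0, if_neg hlq, if_neg hlpq]; ring
      · rw [if_neg hl, if_neg hl0, if_neg hlq, if_neg hlpq]; ring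
  · -- no absorber is overloaded
    intro h hhM hself
    have hsum : ∑ l ∈ Finset.range (j'' + 1), usage x T j'' l h * f l h
        = usage x T j'' p h * (u * (1 - v)) * (if h = p + q then (1:ℝ) else 0)
          + usage x T j'' 0 h * F * (if h = q then (1:ℝ) else 0)
          + usage x T j'' 0 h * R * (if h = p + q then (1:ℝ) else 0) := by
      have e : ∀ l, usage x T j'' l h * f l h
          = (usage x T j'' p h * (u * (1 - v)) * (if h = p + q then (1:ℝ) else 0)) * (if l = p then (1:ℝ) else 0)
            + (usage x T j'' 0 h * F * (if h = q then (1:ℝ) else 0)) * (if l = 0 then (1:ℝ) else 0)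
            + (usage x T j'' 0 h * R * (if h = p + q then (1:ℝ) else 0)) * (if l = 0 then (1:ℝ) else 0) := by
        intro l
        simp only [hf]
        by_cases hl : l = p
        · rw [if_pos hl, if_neg (show l ≠ 0 by omega), hl]; ring
        · by_cases hl0 : l = 0
          · rw [if_neg hl, if_pos hl0, hl0]; ring
          · rw [if_neg hl, if_neg hl0]; ring
      simp only [e, Finset.sum_add_distrib]
      rw [BlobDec2.sum_range_const_indicator _ p (by omega), BlobDec2.sum_range_const_indicator _ 0 (Nat.zero_le _),
        BlobDec2.sum_range_const_indicator _ 0 (Nat.zero_le _)]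
    rw [hsum]
    dsimp only
    have hh0 : h ≠ 0 := by
      rintro rfl
      rcases hself with h1 | h1
      · omega
      · simp at h1; linarith
    have hhp : h ≠ p := by
      rintro rfl
      rcases hself with h1 | h1
      · omega
      · linarith
    by_cases hq : h = q
    · have hpq' : h ≠ p + q := by omega
      rw [if_neg hpq', if_pos hq, if_neg hh0, if_neg hhp]
      simp only [mul_zero, zero_add, add_zero, mul_one]
      have hmq : 0 ≤ (1 - u) * v := mul_nonneg (by linarith) hv0
      rcases hF0.eq_or_lt with hz | hpos
      · rw [← hz, mul_zero]; exact hmq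
      · rw [← hq] at hFq; exact (hFq hpos).2
    · by_cases hpq' : h = p + q
      · rw [if_pos hpq', if_neg hq, if_neg hh0, if_neg hhp]
        simp only [mul_one, mul_zero, add_zero, zero_add]
        rw [← hpq'] at hS
        linarith [hS]
      · rw [if_neg hpq', if_neg hq, if_neg hh0, if_neg hhp]
        simp only [mul_zero, add_zero]
        rfl

end LawDec

end Quant

end Summit.CriticalPhenomena.PercolationContinuityZ3.Theorems
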